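import Literature.Analysis.FluidPDE.NormalisedPressureLpBoundProofs
import HarnessLib

/-!
# Weighted `L^p` bounds for the normalised pressure from bounds on the Hessian convolutions

Analysis/FluidPDE support file (everything PROVED) on the discharge path of the named facts
`Literature.Analysis.FluidPDE.tsai1998_weightedRieszPressure` (`FluidPDE/TsaiWeightedRieszPressure`;
T.-P. Tsai, Arch. Rational Mech. Anal. 143 (1998), §4 p. 45: `RᵢRⱼ` is bounded on
`L^{5/3}(|y|^{-5/3} dy)`) and `Literature.Analysis.FluidPDE.grafakos2014_normalisedPressure_powerWeight_bound`
(`FluidPDE/NormalisedPressurePowerWeightBound`, general power weights).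

The tree realises Tsai's `P̃ = Σ RᵢRⱼ(UᵢUⱼ)` as the normalised pressure `p̃[w]`
(`normalisedPressure`, `FluidPDE/NormalisedPressure`), obtained for test fields `w` as the
pointwise limit of the regularised pressures `Q_ε[w]` (`regPressure`), themselves polarisation
combinations of the 27 regularised Hessian convolutions `H^a_ε[wᵢwⱼ]` (`hessConv`;
`FluidPDE/NormalisedPressureL2Bound`, `regPressure_eq_sum_hessConv`,
`normalisedPressure_eq_limPressure`, `tendsto_regPressure_nat`). The unweighted `L^p` theory
(`FluidPDE/NormalisedPressureLpBoundProofs`, §2–§3) runs: uniform bound for `H^a_ε` ⇒ bound for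
`Q_ε` (polarisation) ⇒ bound for `p̃` (Fatou), everything for Lebesgue measure. **This file
records the two soft steps for an arbitrary measure `μ` on `ℝ³`** — they use nothing about the
measure beyond the triangle inequality in `L^p(μ)` and Fatou's lemma — so that a weighted bound
for the Hessian convolutions (E. M. Stein's power-weight theorem, Proc. AMS 8 (1957), applied
to the kernels `k^a_ε = ∂ₐ∂ₐΦ_ε`) immediately yields the weighted bound for `p̃[w]`:

* `eLpNorm_regPressure_le_of_hessConv` (§2): if `‖H^a_ε[h]‖_{L^p(μ)} ≤ C‖h‖_{L^p(μ)}` for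
  `|a| ≤ 2` and `h ∈ C_c`, then `‖Q_ε[w]‖_{L^p(μ)} ≤ 27C ‖|w|²‖_{L^p(μ)}` (`w ∈ C_c`);
* `eLpNorm_normalisedPressure_le_of_regPressure` (§3): a bound for `Q_{1/(n+1)}[w]` uniform in
  `n` passes to `p̃[w]` (`w ∈ C_c^∞`; Fatou along the pointwise limit);
* `eLpNorm_normalisedPressure_le_of_hessConv` (§3): the composite statement.

It also supplies (§1) the **size condition of Stein's theorem for the regularised kernels,
uniformly in the scale**: `|k^a_ε(z)| ≤ A |a|² / |z|³` for all `ε > 0`, `a`, `z ≠ 0`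
(`exists_bound_abs_hessKernel_le`: off `B̄_ε` the kernel is `-K(z)(a)` with
`|K(z)(a)| ≤ |a|²/(2π|z|³)`, the tree's `abs_pressureKernel_le`; on `B̄_ε` the sup bound
`ε⁻³M|a|²` and `ε⁻³ ≤ |z|⁻³`), and the measurability of `H^a_ε[h]`, `Q_ε[w]` for every measure.

## References

* T.-P. Tsai, *On Leray's self-similar solutions of the Navier–Stokes equations satisfying local
  energy estimates*, Arch. Rational Mech. Anal. 143 (1998), §4 p. 45 [Tsai1998].
* E. M. Stein, *Note on singular integrals*, Proc. Amer. Math. Soc. 8 (1957) 250–254, Theorem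
  (p. 250: the hypothesis `|H(x, x-y)| ≤ A` on the numerator of the kernel) [Stein1957].
* E. M. Stein, *Singular integrals and differentiability properties of functions* (1970),
  Ch. II §4.2 Thm 3 [Stein1971].
-/

noncomputable section

open MeasureTheory Set Filter Topology Function Metric
open scoped ENNReal NNReal RealInnerProductSpace ContDiff

namespace Literature.Analysis.FluidPDE

/-! ## §1. The size of the regularised Hessian kernels: `|k^a_ε(z)| ≤ A |a|² / |z|³` -/

section KernelSize

/-- **Stein's size condition for the regularised kernels, uniformly in the scale** (the
hypothesis `|H| ≤ A` of Stein 1957, Theorem, for `k^a_ε(z) = ∂ₐ∂ₐΦ_ε(z) = H(z)/|z|³`): there is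
`A ≥ 0` with `|k^a_ε(z)| ≤ A |a|² / |z|³` for all `ε > 0`, `a` and `z ≠ 0` (off `B̄_ε`,
`k^a_ε = -K(·)(a)` and `abs_pressureKernel_le`; on `B̄_ε`, `|k^a_ε| ≤ ε⁻³M|a|² ≤ M|a|²/|z|³`).
[cite: Stein1957, Theorem (p. 250)] -/
theorem exists_bound_abs_hessKernel_le :
    ∃ A : ℝ, 0 ≤ A ∧ ∀ ε : ℝ, 0 < ε → ∀ a z : (EuclideanSpace ℝ (Fin 3)), z ≠ 0 →
      |fderiv ℝ (fun s => fderiv ℝ (newtonReg ε) s a) z a| ≤ A * ‖a‖ ^ 2 / ‖z‖ ^ 3 := by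
  obtain ⟨M, hM0, hM⟩ := exists_bound_fderiv_fderiv_newtonReg
  refine ⟨max M (1 / (2 * Real.pi)), le_max_of_le_left hM0, fun ε hε a z hz => ?_⟩
  have hz' : 0 < ‖z‖ := norm_pos_iff.2 hz
  rcases le_or_gt ‖z‖ ε with hle | hlt
  · -- inside the ball: the sup bound and `ε⁻³ ≤ |z|⁻³`
    calc |fderiv ℝ (fun s => fderiv ℝ (newtonReg ε) s a) z a| ≤ ε⁻¹ ^ 3 * M * ‖a‖ ^ 2 :=
          abs_hessKernel_le hM hε a z
      _ ≤ ‖z‖⁻¹ ^ 3 * M * ‖a‖ ^ 2 := by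
          gcongr
      _ = M * ‖a‖ ^ 2 / ‖z‖ ^ 3 := by rw [inv_pow, div_eq_mul_inv]; ring
      _ ≤ max M (1 / (2 * Real.pi)) * ‖a‖ ^ 2 / ‖z‖ ^ 3 := by
          gcongr
          exact le_max_left _ _
  · -- outside the ball: the pressure kernel
    rw [fderiv_fderiv_newtonReg_apply_eq_neg_pressureKernel hε hlt a, abs_neg]
    calc |pressureKernel z a| ≤ ‖a‖ ^ 2 / (2 * Real.pi * ‖z‖ ^ 3) := abs_pressureKernel_le z a
      _ = 1 / (2 * Real.pi) * ‖a‖ ^ 2 / ‖z‖ ^ 3 := by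
          field_simp
      _ ≤ max M (1 / (2 * Real.pi)) * ‖a‖ ^ 2 / ‖z‖ ^ 3 := by
          gcongr
          exact le_max_right _ _

end KernelSize

/-! ## §2. Polarisation in `L^p(μ)` for an arbitrary measure -/

section Polarisation

variable {μ : Measure (EuclideanSpace ℝ (Fin 3))} {p : ℝ≥0∞}

/-- `H^a_ε[h]` is strongly measurable (as a function; hence a.e.-strongly measurable for every
measure on `ℝ³`) for continuous `h`. [folklore] -/
theorem stronglyMeasurable_hessConv (ε : ℝ) {h : (EuclideanSpace ℝ (Fin 3)) → ℝ} (hh : Continuous h) (a : (EuclideanSpace ℝ (Fin 3))) :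
    StronglyMeasurable (hessConv ε h a) :=
  SingularIntegrals.stronglyMeasurable_integral_mul_kernel (μ := volume)
    (continuous_hessKernel ε a).measurable hh.measurable

/-- `Q_ε[w]` is strongly measurable for `w ∈ C_c(ℝ³; ℝ³)` (the polarisation formula
`regPressure_eq_sum_hessConv`). [folklore] -/
theorem stronglyMeasurable_regPressure (ε : ℝ) {w : (EuclideanSpace ℝ (Fin 3)) → (EuclideanSpace ℝ (Fin 3))} (hw : Continuous w)
    (hwc : HasCompactSupport w) : StronglyMeasurable (regPressure ε w) := by
  set b := stdOrthonormalBasis ℝ (EuclideanSpace ℝ (Fin 3))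
  have hfun : regPressure ε w = fun x => -(2⁻¹ * ∑ i, ∑ j,
      (hessConv ε (coordProd w i j) (b i + b j) x - hessConv ε (coordProd w i j) (b i) x -
        hessConv ε (coordProd w i j) (b j) x)) :=
    funext fun x => regPressure_eq_sum_hessConv ε hw hwc x
  rw [hfun]
  refine (StronglyMeasurable.const_mul (Finset.stronglyMeasurable_fun_sum _ fun i _ =>
    Finset.stronglyMeasurable_fun_sum _ fun j _ => ?_) _).neg
  have hm := fun u => stronglyMeasurable_hessConv ε (continuous_coordProd hw i j) u
  exact ((hm _).sub (hm _)).sub (hm _)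

/-- **Polarisation in `L^p(μ)`.** If, at a fixed scale `ε`, the Hessian convolutions satisfy
`‖H^a_ε[h]‖_{L^p(μ)} ≤ C ‖h‖_{L^p(μ)}` for all `|a| ≤ 2` and `h ∈ C_c(ℝ³)` (`1 ≤ p`, `μ` any
measure on `ℝ³`), then `‖Q_ε[w]‖_{L^p(μ)} ≤ 27 C ‖|w|²‖_{L^p(μ)}` for every `w ∈ C_c(ℝ³; ℝ³)`
(`Q_ε = -½Σᵢⱼ(H^{bᵢ+bⱼ} - H^{bᵢ} - H^{bⱼ})[wᵢwⱼ]`, `|wᵢwⱼ| ≤ |w|²`; the Lebesgue-measure case is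
`exists_eLpNorm_regPressure_le` of `NormalisedPressureLpBoundProofs`). [folklore] -/
theorem eLpNorm_regPressure_le_of_hessConv (hp : 1 ≤ p) {C : ℝ≥0∞} {ε : ℝ}
    (hC : ∀ a : (EuclideanSpace ℝ (Fin 3)), ‖a‖ ≤ 2 → ∀ h : (EuclideanSpace ℝ (Fin 3)) → ℝ, Continuous h → HasCompactSupport h →
      eLpNorm (hessConv ε h a) p μ ≤ C * eLpNorm h p μ)
    {w : (EuclideanSpace ℝ (Fin 3)) → (EuclideanSpace ℝ (Fin 3))} (hw : Continuous w) (hwc : HasCompactSupport w) :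
    eLpNorm (regPressure ε w) p μ ≤ 27 * C * eLpNorm (fun y => ‖w y‖ ^ 2) p μ := by
  set b := stdOrthonormalBasis ℝ (EuclideanSpace ℝ (Fin 3))
  set N : ℝ≥0∞ := eLpNorm (fun y => ‖w y‖ ^ 2) p μ with hN
  have hfun : regPressure ε w = -((2⁻¹ : ℝ) • fun x => ∑ i, ∑ j,
      (hessConv ε (coordProd w i j) (b i + b j) x - hessConv ε (coordProd w i j) (b i) x -
        hessConv ε (coordProd w i j) (b j) x)) := by
    funext x
    simp only [Pi.neg_apply, Pi.smul_apply, smul_eq_mul]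
    exact regPressure_eq_sum_hessConv ε hw hwc x
  -- the `L^p(μ)` norm of each `wᵢwⱼ` is at most that of `|w|²`
  have hcp : ∀ i j, eLpNorm (coordProd w i j) p μ ≤ N := fun i j =>
    eLpNorm_mono_real fun y => by
      rw [Real.norm_eq_abs]
      exact abs_coordProd_le w i j y
  have hb1 : ∀ i, ‖b i‖ ≤ 2 := fun i => by rw [b.orthonormal.1]; norm_num
  have hb2 : ∀ i j, ‖b i + b j‖ ≤ 2 := fun i j =>
    (norm_add_le _ _).trans (by rw [b.orthonormal.1, b.orthonormal.1]; norm_num)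
  have hH : ∀ (i j) (u : (EuclideanSpace ℝ (Fin 3))), ‖u‖ ≤ 2 → eLpNorm (hessConv ε (coordProd w i j) u) p μ ≤ C * N :=
    fun i j u hu => (hC u hu (coordProd w i j) (continuous_coordProd hw i j)
      (hasCompactSupport_coordProd hwc i j)).trans (by gcongr; exact hcp i j)
  have hm : ∀ (i j) (u : (EuclideanSpace ℝ (Fin 3))), AEStronglyMeasurable (hessConv ε (coordProd w i j) u) μ :=
    fun i j u => (stronglyMeasurable_hessConv ε (continuous_coordProd hw i j) u).aestronglyMeasurable
  have hterm : ∀ i j, eLpNorm (fun x => hessConv ε (coordProd w i j) (b i + b j) x -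
      hessConv ε (coordProd w i j) (b i) x - hessConv ε (coordProd w i j) (b j) x) p μ ≤
      3 * (C * N) := by
    intro i j
    calc eLpNorm (fun x => hessConv ε (coordProd w i j) (b i + b j) x -
          hessConv ε (coordProd w i j) (b i) x - hessConv ε (coordProd w i j) (b j) x) p μ
        ≤ eLpNorm (fun x => hessConv ε (coordProd w i j) (b i + b j) x -
            hessConv ε (coordProd w i j) (b i) x) p μ +
            eLpNorm (hessConv ε (coordProd w i j) (b j)) p μ :=
          eLpNorm_sub_le ((hm i j _).sub (hm i j _)) (hm i j _) hp
      _ ≤ (eLpNorm (hessConv ε (coordProd w i j) (b i + b j)) p μ +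
            eLpNorm (hessConv ε (coordProd w i j) (b i)) p μ) +
            eLpNorm (hessConv ε (coordProd w i j) (b j)) p μ := by
          gcongr
          exact eLpNorm_sub_le (hm i j _) (hm i j _) hp
      _ ≤ (C * N + C * N) + C * N := by
          gcongr
          · exact hH i j _ (hb2 i j)
          · exact hH i j _ (hb1 i)
          · exact hH i j _ (hb1 j)
      _ = 3 * (C * N) := by ring
  rw [hfun, eLpNorm_neg, eLpNorm_const_smul]
  have hsum : eLpNorm (∑ i, ∑ j, fun x => hessConv ε (coordProd w i j) (b i + b j) x -
      hessConv ε (coordProd w i j) (b i) x - hessConv ε (coordProd w i j) (b j) x) p μ ≤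
      (9 : ℕ) • (3 * (C * N)) := by
    calc eLpNorm (∑ i, ∑ j, fun x => hessConv ε (coordProd w i j) (b i + b j) x -
          hessConv ε (coordProd w i j) (b i) x - hessConv ε (coordProd w i j) (b j) x) p μ
        ≤ ∑ i, eLpNorm (∑ j, fun x => hessConv ε (coordProd w i j) (b i + b j) x -
            hessConv ε (coordProd w i j) (b i) x - hessConv ε (coordProd w i j) (b j) x) p μ :=
          eLpNorm_sum_le (fun i _ => Finset.aestronglyMeasurable_sum _ fun j _ =>
            ((hm i j _).sub (hm i j _)).sub (hm i j _)) hp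
      _ ≤ ∑ i, ∑ j, eLpNorm (fun x => hessConv ε (coordProd w i j) (b i + b j) x -
            hessConv ε (coordProd w i j) (b i) x - hessConv ε (coordProd w i j) (b j) x) p μ :=
          Finset.sum_le_sum fun i _ => eLpNorm_sum_le (fun j _ =>
            ((hm i j _).sub (hm i j _)).sub (hm i j _)) hp
      _ ≤ ∑ _i : Fin (Module.finrank ℝ (EuclideanSpace ℝ (Fin 3))), ∑ _j : Fin (Module.finrank ℝ (EuclideanSpace ℝ (Fin 3))), 3 * (C * N) :=
          Finset.sum_le_sum fun i _ => Finset.sum_le_sum fun j _ => hterm i j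
      _ = (9 : ℕ) • (3 * (C * N)) := by
          rw [Finset.sum_const, Finset.sum_const, Finset.card_univ, Fintype.card_fin,
            finrank_euclideanSpace_fin, smul_smul]
          rfl
  have hfun2 : (∑ i, ∑ j, fun x => hessConv ε (coordProd w i j) (b i + b j) x -
      hessConv ε (coordProd w i j) (b i) x - hessConv ε (coordProd w i j) (b j) x) =
      fun x => ∑ i, ∑ j, (hessConv ε (coordProd w i j) (b i + b j) x -
        hessConv ε (coordProd w i j) (b i) x - hessConv ε (coordProd w i j) (b j) x) := by
    funext x
    simp only [Finset.sum_apply]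
  rw [hfun2] at hsum
  have h2 : ‖(2⁻¹ : ℝ)‖ₑ ≤ 1 := by
    rw [Real.enorm_eq_ofReal (by norm_num)]
    exact ENNReal.ofReal_le_one.2 (by norm_num)
  calc ‖(2⁻¹ : ℝ)‖ₑ * eLpNorm (fun x => ∑ i, ∑ j, (hessConv ε (coordProd w i j) (b i + b j) x -
        hessConv ε (coordProd w i j) (b i) x - hessConv ε (coordProd w i j) (b j) x)) p μ
      ≤ 1 * ((9 : ℕ) • (3 * (C * N))) := mul_le_mul' h2 hsum
    _ = 27 * C * N := by
        rw [one_mul, nsmul_eq_mul]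
        push_cast
        ring

end Polarisation

/-! ## §3. Fatou: from the regularised pressures to `p̃[w]`, in `L^p(μ)` -/

section Fatou

variable {μ : Measure (EuclideanSpace ℝ (Fin 3))} {p : ℝ≥0∞}

/-- **Fatou in `L^p(μ)` along `ε = 1/(n+1)`:** a bound `‖Q_{1/(n+1)}[w]‖_{L^p(μ)} ≤ B`
uniform in `n` passes to the normalised pressure, `‖p̃[w]‖_{L^p(μ)} ≤ B`, for
`w ∈ C_c^∞(ℝ³; ℝ³)` (`p̃[w] = lim Q_ε[w]` pointwise, `normalisedPressure_eq_limPressure`,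
`tendsto_regPressure_nat`; any measure `μ` on `ℝ³`). [folklore] -/
theorem eLpNorm_normalisedPressure_le_of_regPressure {B : ℝ≥0∞} {w : (EuclideanSpace ℝ (Fin 3)) → (EuclideanSpace ℝ (Fin 3))}
    (hw : ContDiff ℝ ∞ w) (hwc : HasCompactSupport w)
    (hB : ∀ n : ℕ, eLpNorm (regPressure (1 / ((n : ℝ) + 1)) w) p μ ≤ B) :
    eLpNorm (normalisedPressure w) p μ ≤ B := by
  have hfun : normalisedPressure w = limPressure w :=
    funext (normalisedPressure_eq_limPressure hw hwc)
  rw [hfun]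
  have hFatou := Lp.eLpNorm_lim_le_liminf_eLpNorm (μ := μ) (p := p)
    (f := fun n : ℕ => regPressure (1 / ((n : ℝ) + 1)) w)
    (fun n => (stronglyMeasurable_regPressure (1 / ((n : ℝ) + 1)) hw.continuous hwc).aestronglyMeasurable)
    (limPressure w) (Eventually.of_forall fun x => tendsto_regPressure_nat hw hwc x)
  exact hFatou.trans (liminf_le_of_frequently_le' (Eventually.of_forall hB).frequently)

/-- **Weighted `L^p` bound for the normalised pressure from a weighted bound on the Hessian
convolutions** (the soft half of Tsai 1998, p. 45 / Stein 1970, Ch. II §4.2 Thm 3, for an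
arbitrary measure `μ` on `ℝ³` and `1 ≤ p`): if `‖H^a_ε[h]‖_{L^p(μ)} ≤ C ‖h‖_{L^p(μ)}` for all
`ε > 0`, `|a| ≤ 2` and `h ∈ C_c(ℝ³)`, then `‖p̃[w]‖_{L^p(μ)} ≤ 27 C ‖|w|²‖_{L^p(μ)}` for every
`w ∈ C_c^∞(ℝ³; ℝ³)` (polarisation, §2, and Fatou). [folklore] -/
theorem eLpNorm_normalisedPressure_le_of_hessConv (hp : 1 ≤ p) {C : ℝ≥0∞}
    (hC : ∀ ε : ℝ, 0 < ε → ∀ a : (EuclideanSpace ℝ (Fin 3)), ‖a‖ ≤ 2 → ∀ h : (EuclideanSpace ℝ (Fin 3)) → ℝ, Continuous h →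
      HasCompactSupport h → eLpNorm (hessConv ε h a) p μ ≤ C * eLpNorm h p μ)
    {w : (EuclideanSpace ℝ (Fin 3)) → (EuclideanSpace ℝ (Fin 3))} (hw : ContDiff ℝ ∞ w) (hwc : HasCompactSupport w) :
    eLpNorm (normalisedPressure w) p μ ≤ 27 * C * eLpNorm (fun y => ‖w y‖ ^ 2) p μ :=
  eLpNorm_normalisedPressure_le_of_regPressure hw hwc fun n =>
    eLpNorm_regPressure_le_of_hessConv hp (hC _ (one_div_pos.2 (Nat.cast_add_one_pos n)))
      hw.continuous hwc

end Fatou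

end Literature.Analysis.FluidPDE

end
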